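import Summits.CriticalPhenomena.PercolationContinuityZ3.Theorems.PercNearOneGluingNoHeavyLowerTailKNConj4OfCSH
import HarnessLib

/-!
# `NoHeavyLowerTail` (stmt-CriticalPhenomena-4575) — the QUANTITATIVE LEMMA AC of the conditioned slack hierarchy:
# `Marg[μ(· ↔ x | x ↮ Y)] ≥ μ(o ↔ x | x ↮ Y ∪ D ∪ {v})`

Support file (`--supports stmt-CriticalPhenomena-4575`), prover `prim-ineq-gen-6` (gen 9; memo `prim-ineq-gen-6/FINDING-G9.md` §1).
No definitions, no named facts, no sorries; standard axioms.  First of three files proving the quantitative Kozma–Nitzan inequality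
(Q-KN, conjectured in `prim-ineq-gen-6/FINDING-G4.md` §8): `…QuantitativeLemmaAC` (this file) → `…QuantitativeKNMargin` → `…QuantitativeKN`.

prim-hp-8's Lemma AC (used in `CSH.s5dMargin_nonneg_of_csh` and in gen 8's `PreFKGSurplus.preMargin_nonneg_of_csh`) says that the level-form
margin of the decoy constant `c_x = μ(· ↔ x | x ↮ Y)` is `≥ 0` (CSH applied to `Ψ_iso`).  THIS FILE: the sharp lower bound

  `Marg_{L,p;o,v}[c_x] ≥ μ(o ↔ x | x ↮ Y ∪ D ∪ {v})`      (`CSH.avoidConst_le_cshMarg`),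

i.e. at least the attachment probability of `o` to `x` conditioned on `x` avoiding EVERY named vertex.  It is ONE application of the
conditioned slack hierarchy `CSH.CSHHolds` (prim-hp-8's Theorem 1, tree `CSH.cshAll`) to the increasing touch functional
`1{C_x touches T}`, `T = D ∪ {v}` (the indicator of the upper family `⋃_{t∈T} connFamily x t`): its denominator-free conditional covariance is
`covD = μ(x↮Y)·μ(x↮Y∪T)·(μ(·↔x | x↮Y) − μ(·↔x | x↮Y∪T))` (`CSH.covD_touch`), the margin is linear, and the level form FIXES the second function
because it vanishes at every decoy and at `v` (`CSH.slForm_eq_self_of_forall_eq_zero`).  For one decoy this is Kozma–Nitzan's Lemma 2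
(`φ(x d) ≥ φ(x) + φ(d)`) read through Lemma 1.
[cite: KozmaNitzan2024, Lemmas 1–2 (pp. 5–6)] [cite: VandenbergHaggstromKahn2005, Thm. 1.3 (p. 6), §1 p. 3]
-/

noncomputable section

namespace Summit.CriticalPhenomena.PercolationContinuityZ3.Theorems

open MeasureTheory Set Literature.Probability.LatticeModels Literature.Probability.Percolation
open scoped Classical
open KNPreFKG CSH

namespace CSH

variable {V : Type*}

/-! ### The level form fixes every function vanishing at the decoys -/

/-- A function vanishing at every decoy of `L` is fixed by the level form `sl_L`. [folklore] -/
theorem slForm_eq_self_of_forall_eq_zero (L : List (V × (V → ℝ))) {f : V → ℝ} (hf : ∀ dc ∈ L, f dc.1 = 0) :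
    slForm L f = f := by
  induction L generalizing f with
  | nil => rfl
  | cons dc L ih =>
      have hstep : slStep dc f = f := by
        funext u
        simp only [slStep, hf dc List.mem_cons_self, mul_zero, sub_zero]
      rw [slForm_cons_eq, hstep]
      exact ih fun dc' hdc' => hf dc' (List.mem_cons_of_mem _ hdc')

variable [Fintype V]

/-! ### The touch functional `1{C_x touches T}` and its conditional covariance -/

/-- **`covD` of the touch functional.**  For the increasing functional `1{C_x touches T}` (the indicator of the upper family
`⋃_{t ∈ T} connFamily x t`, so that `1{C_x(ω) touches T} = 1{x ↔ T}(ω)`), the denominator-free conditional covariance against `1{x ↔ u}`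
given `D = {x ↮ Y}` is  `covD(u) = μ(D')·μ(D ∩ {x↔u}) − μ(D)·μ(D' ∩ {x↔u})`,  `D' = {x ↮ Y ∪ T}`. [cite: VandenbergHaggstromKahn2005, §1 p. 3] -/
theorem covD_touch (w : Sym2 V → unitInterval) (x : V) (Y T : Set V) (u : V) :
    covD w x Y ((⋃ t ∈ T, connFamily x t).indicator (1 : Set (Sym2 V) → ℝ)) u =
      (prodBernoulli w).real {ω : BondConfig V | ∀ y ∈ Y ∪ T, ¬ (openGraph ω).Reachable x y} *
          (prodBernoulli w).real ({ω : BondConfig V | ∀ y ∈ Y, ¬ (openGraph ω).Reachable x y} ∩ openConn x u) -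
        (prodBernoulli w).real {ω : BondConfig V | ∀ y ∈ Y, ¬ (openGraph ω).Reachable x y} *
          (prodBernoulli w).real ({ω : BondConfig V | ∀ y ∈ Y ∪ T, ¬ (openGraph ω).Reachable x y} ∩ openConn x u) := by
  classical
  set μ := prodBernoulli w with hμ
  have hmeas : ∀ S : Set (BondConfig V), MeasurableSet S := fun _ => MeasurableSet.of_discrete
  set D : Set (BondConfig V) := {ω : BondConfig V | ∀ y ∈ Y, ¬ (openGraph ω).Reachable x y} with hD
  set U : Set (BondConfig V) := {ω : BondConfig V | openEdgeCluster ω x ∈ ⋃ t ∈ T, connFamily x t} with hU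
  -- the touch event read on configurations
  have hUc : D \ U = {ω : BondConfig V | ∀ y ∈ Y ∪ T, ¬ (openGraph ω).Reachable x y} := by
    ext ω
    simp only [hD, hU, mem_sdiff, mem_setOf_eq, mem_iUnion, exists_prop, not_exists, not_and, mem_union]
    constructor
    · rintro ⟨h1, h2⟩ y hy
      rcases hy with hy | hy
      · exact h1 y hy
      · intro hr
        exact h2 y hy ((reachable_iff_exists_mem_openEdgeCluster ω x y).1 hr)
    · intro h
      refine ⟨fun y hy => h y (Or.inl hy), fun t ht hC => h t (Or.inr ht) ?_⟩
      exact (reachable_iff_exists_mem_openEdgeCluster ω x t).2 hC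
  have hind : (fun ω : BondConfig V => (⋃ t ∈ T, connFamily x t).indicator (1 : Set (Sym2 V) → ℝ) (openEdgeCluster ω x)) =
      U.indicator 1 := indicator_comp_openEdgeCluster _ x
  have hI : ∀ S : Set (BondConfig V),
      ∫ ω in S, (⋃ t ∈ T, connFamily x t).indicator (1 : Set (Sym2 V) → ℝ) (openEdgeCluster ω x) ∂μ = μ.real (S ∩ U) := by
    intro S
    rw [show (fun ω : BondConfig V => (⋃ t ∈ T, connFamily x t).indicator (1 : Set (Sym2 V) → ℝ) (openEdgeCluster ω x)) =
      U.indicator 1 from hind]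
    exact setIntegral_indicator_one_eq μ S U
  -- split `μ(S ∩ U) = μ(S) − μ(S \ U)`
  have hsplit : ∀ S : Set (BondConfig V), μ.real (S ∩ U) = μ.real S - μ.real (S \ U) := by
    intro S
    have h := measureReal_inter_add_sdiff (μ := μ) (s := S) (t := U) (hmeas U)
    linarith
  unfold covD
  simp only [← hμ]
  rw [← hD, hI, hI, hsplit, hsplit, inter_sdiff_right_comm, hUc]
  ring

/-- **THE QUANTITATIVE LEMMA AC** (gen 9).  If the conditioned slack hierarchy `CSH(Y; x; D; o, v)` holds (non-degenerate weights, `x ∉ Y`,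
`x ∉ D`, `x ≠ v`), then the level-form margin of the decoy constant `c_x = μ(· ↔ x | x ↮ Y)` is at least the attachment probability of `o`
to `x` conditioned on `x` avoiding EVERYTHING named:  `Marg_{L,p;o,v}[c_x] ≥ μ(o ↔ x | x ↮ Y ∪ D ∪ {v})`.  (prim-hp-8's Lemma AC is `≥ 0`.)
Proof: CSH for the touch functional `1{C_x touches D ∪ {v}}`, `covD_touch`, and the level form fixes `μ(· ↔ x | x ↮ Y ∪ D ∪ {v})`, which
vanishes at the decoys and at `v`. [cite: KozmaNitzan2024, Lemma 2 (p. 6)] [cite: VandenbergHaggstromKahn2005, Thm. 1.3 (p. 6)] -/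
theorem avoidConst_le_cshMarg (w : Sym2 V → unitInterval) (hw : ∀ e, 0 < w e ∧ w e < 1) (x : V) (Y : Set V) (D : List V) (o v : V)
    (hxY : x ∉ Y) (hxD : x ∉ D) (hxv : x ≠ v) (hCSH : CSHHolds w x Y D o v) :
    avoidConst w x (Y ∪ ({d | d ∈ D} ∪ {v})) o ≤
      cshMarg (decoyList w (insert x Y) D) (obsConst w o v (insert x Y ∪ {d | d ∈ D})) o v (avoidConst w x Y) := by
  classical
  set μ := prodBernoulli w with hμ
  set T : Set V := {d | d ∈ D} ∪ {v} with hT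
  set L := decoyList w (insert x Y) D with hL
  set p : ℝ := obsConst w o v (insert x Y ∪ {d | d ∈ D}) with hp
  set Dv : Set (BondConfig V) := {ω : BondConfig V | ∀ y ∈ Y, ¬ (openGraph ω).Reachable x y} with hDv
  set D' : Set (BondConfig V) := {ω : BondConfig V | ∀ y ∈ Y ∪ T, ¬ (openGraph ω).Reachable x y} with hD'
  -- positivity of the two conditioning events
  have hempty' : (∅ : BondConfig V) ∈ D' := by
    intro y hy h
    rw [HullPort.reachable_empty_iff] at h
    subst h
    rcases hy with hy | hy | hy
    · exact hxY hy
    · exact hxD hy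
    · exact hxv hy
  have hD'pos : 0 < μ.real D' := prodBernoulli_real_pos_of_nonempty hw ⟨∅, hempty'⟩
  have hDvpos : 0 < μ.real Dv :=
    prodBernoulli_real_pos_of_nonempty hw ⟨∅, fun y hy => hempty' y (Or.inl hy)⟩
  -- the touch functional is monotone, so CSH applies
  have hup : IsUpperSet (⋃ t ∈ T, connFamily x t) := isUpperSet_iUnion₂ fun t _ => isUpperSet_connFamily x t
  have h0 : 0 ≤ cshMarg L p o v (covD w x Y ((⋃ t ∈ T, connFamily x t).indicator (1 : Set (Sym2 V) → ℝ))) :=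
    hCSH _ (monotone_indicator_one_of_isUpperSet hup)
  -- `covD(touch) = μ(Dv)μ(D') • (c_x − c_x')`
  have hcov : covD w x Y ((⋃ t ∈ T, connFamily x t).indicator (1 : Set (Sym2 V) → ℝ)) =
      (μ.real Dv * μ.real D') • (avoidConst w x Y - avoidConst w x (Y ∪ T)) := by
    funext u
    rw [covD_touch, Pi.smul_apply, Pi.sub_apply, smul_eq_mul]
    simp only [avoidConst, ← hDv, ← hD', ← hμ]
    field_simp
  rw [hcov, cshMarg_smul, cshMarg_sub] at h0
  -- the level form fixes `c_x'`, which vanishes at the decoys and at `v`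
  have hvan : ∀ u ∈ T, avoidConst w x (Y ∪ T) u = 0 := by
    intro u hu
    simp only [avoidConst]
    rw [← hD']
    have he : D' ∩ (openConn x u : Set (BondConfig V)) = ∅ := by
      ext ω
      simp only [mem_inter_iff, mem_empty_iff_false, iff_false, not_and]
      intro hω hxu
      exact hω u (Or.inr hu) hxu
    rw [he, measureReal_empty, zero_div]
  have hfix : cshMarg L p o v (avoidConst w x (Y ∪ T)) = avoidConst w x (Y ∪ T) o := by
    simp only [cshMarg]
    rw [slForm_eq_self_of_forall_eq_zero L (fun dc hdc => hvan dc.1 (Or.inl (mem_decoyList w _ D dc hdc))),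
      hvan v (Or.inr rfl), mul_zero, sub_zero]
  rw [hfix] at h0
  have hκ : 0 < μ.real Dv * μ.real D' := mul_pos hDvpos hD'pos
  have h1 : 0 ≤ cshMarg L p o v (avoidConst w x Y) - avoidConst w x (Y ∪ T) o := (mul_nonneg_iff_of_pos_left hκ).1 h0
  linarith

end CSH

end Summit.CriticalPhenomena.PercolationContinuityZ3.Theorems

end
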